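import Summits.Ventures.HSemireg.GeneralStructureWiringBloch
import Summits.Ventures.HSemireg.GeneralStructureWiringBlochFamilies
import Summits.Ventures.HSemireg.GeneralStructureWiringBlochCharted
import Summits.Ventures.HSemireg.GeneralStructureWiringPrimitiveMiddle
import Summits.HodgeConjecture.HodgeConjecture.Theorems.PadicSemiregularLiftHodgeAbelianVarietiesStubCmAnchoredFamilies
import HarnessLib

/-!
# HSemireg venture · general structure (G4) — the WIRING, CONVERSES: the cycle-side forms are bounded ABOVE by `HC_AV` (red-team findings GS-13 / GS-14, landed)

HONEST FRAMING (speculative tier of cell `pub-hsemireg`, team «general structure», seat G4; verbatim the cell's wording rule):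
**nothing here says `HC_AV` or `HC_CM` is proved; every implication carries its named hypotheses.** No `sorry`, no new definition, no new
axiom; axioms `propext`, `Classical.choice`, `Quot.sound`. `HC_AV` = `Theses.PadicSemiregularLift.HodgeAbelianVarieties` (stmt-1333); `HC_CM` =
`Theses.RankFourFaces.CMAbelianHodge` (stmt-3052). Every theorem below has `HC_AV` (or the summit) as a HYPOTHESIS: these are position /
honesty theorems, the opposite of progress claims.

The red team (RED-GS GS-13, GS-14, gs-red gen 3, 2026-08-22T06:24–06:26Z; probes `general-structure/RED-GS-probe-GS13-converse.lean`,
`…-probe-GS14-uniform.lean`, kernel-checked there; TRANSPLANTED here with attribution so that the rows and their converses live side by side in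
the tree) observed that the CYCLE-side hypotheses carry a free correction class `H` («rational and algebraic on every fibre») and a first
disjunct `(W - H)|_{s₀} = 0`, so that `H := W` satisfies them as soon as `W` is algebraic on every fibre — which `HC_AV` grants:

* §1 (GS-13) `blochPresentedFamilies_of_hc_av`, `blochPresentedChartedFamilies_of_hc_av` (constant family over `Spec ℂ`, `W := c`, `H := c`),
  hence `blochPresentedFamilies_iff_hc_av`, `blochPresentedChartedFamilies_iff_hc_av` (granted Bloch 7.4 for `→`): the two cycle-side
  ∃-OVER-FAMILIES hypotheses are EQUIVALENT to `HC_AV`. CONSEQUENCE (wording of record): rows BF-1 / BC-1 (`hc_av_of_blochSpread_of_blochPresented[Charted]Families`)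
  are RESTATEMENTS of `HC_AV`, not reductions — «HC_AV modulo {Bloch 7.4, BlochPresentedFamilies}» has zero reduction content; Bloch's 1972
  reduction lives in the per-family INSTANCES (one Bloch-`π` certificate at one point of ONE family ⟹ the class is algebraic on every fibre of
  THAT family = Bloch 7.4 + Charles–Schnell 11.3.11, the printed transfer), not in the row.
* §2 (GS-14) `uniformBlochLiftAtCM_of_hc_av_of_catanese` and its thinned twin: the cycle ∀-FORMS `UniformBlochLiftAtCM`,
  `UniformBlochLiftAtCMPrimitiveMiddle` are IMPLIED by `HC_AV` (+ Catanese 2002 as typed: every fibre abelian, so `HC_AV` makes `G` algebraic on every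
  fibre and `H := G` works — the team's own `blochLift_conclusion_of_fibrewise_algebraic`). POSITION (kernel, `uniformBlochLift_sandwich`): modulo
  {Deligne 1982 Prop. 6.1, Bloch 7.4, Catanese 4.1}, `HC_CM ∧ UniformBlochLiftAtCM ↔ HC_AV` — the cycle ∀-form is a statement BETWEEN `CMToAbelian`
  (stmt-16267) and `HC_AV`; its content is the TRANSPORT of algebraicity from the CM fibre along the component («semiregular representative
  optional»: the semiregular disjunct is never needed if `HC_AV` is true). LABEL CHANGE of record: the referee label «plausibly false as a
  `∀`-statement» (ring 2, ref1 F5) does NOT apply to the cycle forms — refuting `UniformBlochLiftAtCM` would refute `HC_AV` modulo Catanese;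
  it remains in force for the SHEAF forms only (`UniformSemiregularSheafLiftAtCM`, `…PrimitiveMiddle` (sheaf), `ExistsSemiregularSheafCMAnchor[Dense]`),
  which have NO `H`-hatch, are NOT implied by `HC_AV` (their point-base shadow (★), `existsAnchor_pointBase`, asks for SEMIREGULAR presentations,
  and their horizontality clause for the individual `ch_q(E_i)` is a Hodge-theoretic condition `HC_AV` does not supply), and are certified strict
  strengthenings (GS-9).
* §3 the sheaf-side witness form `SemiregularPresentedFamilies C` is NOT given by `HC_AV` cheaply (no `H`-hatch; RED-GS GS-13 contrast) — nothing
  to prove; recorded in prose.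

## References (bib keys)

Bloch1972Semiregularity (Introduction p. 51; Thm. 7.4, Remark 7.5), Deligne1982HodgeCycles (Prop. 6.1; §4), Catanese2002DeformationTypes (§4 Thm. 4.1, 4.6),
CharlesSchnell2014Notes (Prop. 11.3.11, Thm. 11.5.11), MumfordAV1970 (§22).
-/

noncomputable section

open CategoryTheory MonoidalCategory
open Literature.AlgebraicGeometry Literature.AlgebraicGeometry.Motives
open Literature.AlgebraicGeometry.HodgeTheory
open Literature.AlgebraicGeometry.Deligne1982 (deligne1982_cmDenseMumfordTateFamilies)

namespace Summit.Ventures.HSemireg.GeneralStructure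

open Summit.HodgeConjecture.HodgeConjecture
open Summit.HodgeConjecture.HodgeConjecture.Ring2.Hypotheses (CMAnchoredFamilies hc_av_iff_hc_cm_and_cmToAbelian)
open Summit.HodgeConjecture.HodgeConjecture.Ring2Transport (HodgeWeilType hodgeAbelianVarieties_iff_hodgeWeilType)
open Summit.HodgeConjecture.HodgeConjecture.Cruxes.HodgeAbelianVarieties.SubtorusGalleryBlochSeeds.Stubs
  (unit_base isSmoothProjectiveFamily_toUnit isIso_fiberι_toUnit)

/-! ### §1 GS-13: the cycle-side ∃-over-families hypotheses are EQUIVALENT to `HC_AV` -/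

/-- **GS-13 (a): `HC_AV ⟹ BlochPresentedFamilies`** (red-team probe, transplanted): the constant family `A ⟶ Spec ℂ` (`Stubs.unit_base`,
`isSmoothProjectiveFamily_toUnit`, `isIso_fiberι_toUnit`), `W := c`, chart `(ι_u)⁻¹`, correction `H := c` and the FIRST disjunct `(W - H)| = 0`;
`HC_AV` supplies only «`c` algebraic», no lci, no semiregularity, no Bloch fact. [cite: Bloch1972Semiregularity, Remark (7.5)] [cite: MumfordAV1970, §22] -/
theorem blochPresentedFamilies_of_hc_av (h : Theses.PadicSemiregularLift.HodgeAbelianVarieties) : BlochPresentedFamilies := by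
  intro A p c hc hh
  obtain ⟨hS, hsm, hirr⟩ := unit_base
  have h𝒳 : IsQuasiProjectiveOver A.X :=
    IsQuasiProjectiveOver.of_isProjectiveOver (AbelianVariety.isSmoothProjective_holds (A := A)).isProjectiveOver
  set f := CartesianMonoidalCategory.toUnit A.X with hfdef
  have hf : IsSmoothProjectiveFamily f A.dim := isSmoothProjectiveFamily_toUnit A
  have hfib : ∀ s : ComplexPoints (𝟙_ (SchemeOver ℂ)), IsIso (fiberι f s) := isIso_fiberι_toUnit A
  let u : ComplexPoints (𝟙_ (SchemeOver ℂ)) := Classical.arbitrary _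
  haveI := hfib u
  have halg : c ∈ algebraicClasses A.X p := (h A).2 p c hc hh
  refine ⟨A.X, 𝟙_ (SchemeOver ℂ), f, u, (asIso (fiberι f u)).symm, c, hf, h𝒳, hS, hirr, hsm, ?_, ?_, ?_⟩
  · intro s
    haveI := hfib s
    exact ⟨(isRationalClass_map_iff_of_iso (asIso (fiberι f s))).2 hc,
      (isOfHodgeType_map_iff_of_iso (asIso (fiberι f s))).2 hh⟩
  · simpa using (asIso (fiberι f u)).complexBetti_map_inv_map_hom (2 * p) c
  · refine ⟨u, c, ?_, Or.inl (by rw [sub_self, map_zero])⟩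
    intro t
    haveI := hfib t
    exact ⟨(isRationalClass_map_iff_of_iso (asIso (fiberι f t))).2 hc,
      (mem_algebraicClasses_map_iff_of_iso (asIso (fiberι f t))).2 halg⟩

/-- **GS-13 (b): `HC_AV ⟹ BlochPresentedChartedFamilies`** (same construction, model `X₀ := 𝒳_u`, chart `Iso.refl`).
[cite: Bloch1972Semiregularity, Remark (7.5)] [cite: MumfordAV1970, §22] -/
theorem blochPresentedChartedFamilies_of_hc_av (h : Theses.PadicSemiregularLift.HodgeAbelianVarieties) :
    BlochPresentedChartedFamilies := by
  intro A p c hc hh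
  obtain ⟨hS, hsm, hirr⟩ := unit_base
  have h𝒳 : IsQuasiProjectiveOver A.X :=
    IsQuasiProjectiveOver.of_isProjectiveOver (AbelianVariety.isSmoothProjective_holds (A := A)).isProjectiveOver
  set f := CartesianMonoidalCategory.toUnit A.X with hfdef
  have hf : IsSmoothProjectiveFamily f A.dim := isSmoothProjectiveFamily_toUnit A
  have hfib : ∀ s : ComplexPoints (𝟙_ (SchemeOver ℂ)), IsIso (fiberι f s) := isIso_fiberι_toUnit A
  let u : ComplexPoints (𝟙_ (SchemeOver ℂ)) := Classical.arbitrary _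
  haveI := hfib u
  have halg : c ∈ algebraicClasses A.X p := (h A).2 p c hc hh
  refine ⟨A.X, 𝟙_ (SchemeOver ℂ), f, u, (asIso (fiberι f u)).symm, c, hf, h𝒳, hS, hirr, hsm, ?_, ?_, ?_⟩
  · intro s
    haveI := hfib s
    exact ⟨(isRationalClass_map_iff_of_iso (asIso (fiberι f s))).2 hc,
      (isOfHodgeType_map_iff_of_iso (asIso (fiberι f s))).2 hh⟩
  · simpa using (asIso (fiberι f u)).complexBetti_map_inv_map_hom (2 * p) c
  · refine ⟨u, c, fiberOver f u, Iso.refl _, ?_, Or.inl (by rw [sub_self, map_zero])⟩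
    intro t
    haveI := hfib t
    exact ⟨(isRationalClass_map_iff_of_iso (asIso (fiberι f t))).2 hc,
      (mem_algebraicClasses_map_iff_of_iso (asIso (fiberι f t))).2 halg⟩

/-- **GS-13: `BlochPresentedFamilies ↔ HC_AV`** granted Bloch 7.4 (the row BF-1 is the `→`). WORDING OF RECORD: the ∃-over-families cycle row is a
RESTATEMENT of `HC_AV`; the reduction content is in the per-family instances only. [cite: Bloch1972Semiregularity, Thm. (7.4) and Remark (7.5)] -/
theorem blochPresentedFamilies_iff_hc_av (hB : ∀ m p : ℕ, BlochSemiregularSpread m p) :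
    BlochPresentedFamilies ↔ Theses.PadicSemiregularLift.HodgeAbelianVarieties :=
  ⟨hc_av_of_blochSpread_of_blochPresentedFamilies hB, blochPresentedFamilies_of_hc_av⟩

/-- **GS-13: `BlochPresentedChartedFamilies ↔ HC_AV`** granted Bloch 7.4. [cite: Bloch1972Semiregularity, Thm. (7.4) and Remark (7.5)] -/
theorem blochPresentedChartedFamilies_iff_hc_av (hB : ∀ m p : ℕ, BlochSemiregularSpread m p) :
    BlochPresentedChartedFamilies ↔ Theses.PadicSemiregularLift.HodgeAbelianVarieties :=
  ⟨hc_av_of_blochSpread_of_blochPresentedChartedFamilies hB, blochPresentedChartedFamilies_of_hc_av⟩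

/-- … and `↔ HodgeWeilType` (ring 2's exactness), for the record. [cite: Deligne1982HodgeCycles, §4 Lemma 4.5 and Remark 4.10] -/
theorem blochPresentedFamilies_iff_hodgeWeilType (hB : ∀ m p : ℕ, BlochSemiregularSpread m p) :
    BlochPresentedFamilies ↔ HodgeWeilType :=
  (blochPresentedFamilies_iff_hc_av hB).trans hodgeAbelianVarieties_iff_hodgeWeilType

/-! ### §2 GS-14: the cycle ∀-forms are implied by `HC_AV` (+ Catanese) — the sandwich -/

/-- **GS-14: `HC_AV ∧ [Catanese 2002] ⟹ UniformBlochLiftAtCM`** (red-team probe, transplanted): Catanese presents every fibre as an abelian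
variety, `HodgeAlong` + `HC_AV` make `G` rational and algebraic on every fibre, and `H := G` closes the first disjunct
(`blochLift_conclusion_of_fibrewise_algebraic`). The CM hypothesis and the algebraic-at-`A₀` hypothesis are idle in this direction.
[cite: Catanese2002DeformationTypes, §4 Thm. 4.1 and Thm. 4.6] [cite: Bloch1972Semiregularity, Remark (7.5)] -/
theorem uniformBlochLiftAtCM_of_hc_av_of_catanese (h : Theses.PadicSemiregularLift.HodgeAbelianVarieties)
    (hC : catanese2002_abelianFibres_of_abelianFibre) : UniformBlochLiftAtCM := by
  intro S 𝒳 f m p G s₀ A₀ e₀ h𝒳 hS hsm hirr hf hA₀ _ _ hG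
  obtain ⟨i₀, -⟩ := hA₀
  have hq𝒳 : IsQuasiProjectiveOver 𝒳 := h𝒳
  have hqS : IsQuasiProjectiveOver S := hS
  have hdim : A₀.dim = m := Ring2.Binders.dim_eq_of_iso_fiberOver hf i₀
  have hfam : IsSmoothProjectiveFamily f A₀.dim := hdim ▸ hf
  have hGfib : ∀ t : ComplexPoints S,
      IsRationalClass (complexBetti.map (fiberι f t) (2 * p) G) ∧
        complexBetti.map (fiberι f t) (2 * p) G ∈ algebraicClasses (fiberOver f t) p := by
    intro s
    obtain ⟨B, -, ⟨iB⟩⟩ := hC f A₀ hq𝒳 hqS hirr hsm hfam ⟨s₀, ⟨i₀⟩⟩ s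
    have hh := hG B (iB.hom ≫ fiberι f s) s ⟨iB, rfl⟩
    have he : complexBetti.map (iB.hom ≫ fiberι f s) (2 * p) G =
        complexBetti.map iB.hom (2 * p) (complexBetti.map (fiberι f s) (2 * p) G) := by
      rw [complexBetti.map_comp]
      rfl
    rw [he] at hh
    have halgB : complexBetti.map iB.hom (2 * p) (complexBetti.map (fiberι f s) (2 * p) G) ∈
        algebraicClasses B.X p := (h B).2 p _ hh.1 hh.2
    exact ⟨(isRationalClass_map_iff_of_iso iB).1 hh.1, (mem_algebraicClasses_map_iff_of_iso iB).1 halgB⟩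
  exact blochLift_conclusion_of_fibrewise_algebraic f m p G A₀ e₀ hGfib

/-- **GS-14, thinned: `HC_AV ∧ [Catanese 2002] ⟹ UniformBlochLiftAtCMPrimitiveMiddle`** (the extra binders are carried, not used).
[cite: Catanese2002DeformationTypes, §4 Thm. 4.1 and Thm. 4.6] -/
theorem uniformBlochLiftAtCMPrimitiveMiddle_of_hc_av_of_catanese (h : Theses.PadicSemiregularLift.HodgeAbelianVarieties)
    (hC : catanese2002_abelianFibres_of_abelianFibre) : UniformBlochLiftAtCMPrimitiveMiddle :=
  fun S 𝒳 f m p G s₀ A₀ e₀ _ _ _ h𝒳 hS hsm hirr hf hA₀ hcm halg hG _ _ _ ↦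
    uniformBlochLiftAtCM_of_hc_av_of_catanese h hC S 𝒳 f m p G s₀ A₀ e₀ h𝒳 hS hsm hirr hf hA₀ hcm halg hG

/-- **THE SANDWICH (position of record for the cycle ∀-form): modulo {Deligne 1982 Prop. 6.1, Bloch 7.4, Catanese 2002},
`HC_CM ∧ UniformBlochLiftAtCM ↔ HC_AV`.** (→) is the landed row B-2 (`hc_av_of_hc_cm_of_deligne1982_of_blochSpread_of_catanese_of_uniformBlochLift`);
(←) is `HC_AV ⟹ HC_CM` (`Ring2.Deform.HC_CM_of_HC_AV`) and GS-14. So the cycle ∀-form is a statement between `CMToAbelian` (B-4) and `HC_AV`: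
its content is the transport of algebraicity from the CM fibre; a semiregular representative is a proof strategy for an instance, not something
the hypothesis asserts. [cite: Deligne1982HodgeCycles, Prop. 6.1] [cite: Bloch1972Semiregularity, Thm. (7.4)] [cite: Catanese2002DeformationTypes, §4 Thm. 4.1] -/
theorem uniformBlochLift_sandwich (hD : deligne1982_cmDenseMumfordTateFamilies) (hB : ∀ m p : ℕ, BlochSemiregularSpread m p)
    (hC : catanese2002_abelianFibres_of_abelianFibre) :
    (Theses.RankFourFaces.CMAbelianHodge ∧ UniformBlochLiftAtCM) ↔ Theses.PadicSemiregularLift.HodgeAbelianVarieties :=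
  ⟨fun h ↦ hc_av_of_hc_cm_of_deligne1982_of_blochSpread_of_catanese_of_uniformBlochLift h.1 hD hB hC h.2,
    fun h ↦ ⟨Ring2.Deform.HC_CM_of_HC_AV h, uniformBlochLiftAtCM_of_hc_av_of_catanese h hC⟩⟩

/-- The sandwich, lower half made explicit (kernel conjunction): `UniformBlochLiftAtCM ⟹ CMToAbelian` modulo {anchors, Bloch, Catanese}
(landed B-4) and `HC_AV ⟹ UniformBlochLiftAtCM` modulo Catanese; and `HC_AV ↔ HC_CM ∧ CMToAbelian`. ON-PATH: the summit gives the cycle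
∀-form (`HodgeConjecture → HC_AV`, `Ring2.Deform.HC_AV_of_hodgeConjecture`). [cite: Deligne1982HodgeCycles, Prop. 6.1]
[cite: Catanese2002DeformationTypes, §4 Thm. 4.1] -/
theorem uniformBlochLift_position (hC : catanese2002_abelianFibres_of_abelianFibre) :
    (CMAnchoredFamilies → (∀ m p : ℕ, BlochSemiregularSpread m p) → UniformBlochLiftAtCM → Theses.RankFourFaces.CMToAbelian) ∧
    (Theses.PadicSemiregularLift.HodgeAbelianVarieties → UniformBlochLiftAtCM) ∧
    (_root_.HodgeConjecture → UniformBlochLiftAtCM) ∧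
    (Theses.PadicSemiregularLift.HodgeAbelianVarieties ↔
      Theses.RankFourFaces.CMAbelianHodge ∧ Theses.RankFourFaces.CMToAbelian) :=
  ⟨fun hMT hB hL ↦ cmToAbelian_of_cmAnchoredFamilies_of_blochSpread_of_catanese_of_uniformBlochLift hMT hB hC hL,
    fun h ↦ uniformBlochLiftAtCM_of_hc_av_of_catanese h hC,
    fun h ↦ uniformBlochLiftAtCM_of_hc_av_of_catanese (Ring2.Deform.HC_AV_of_hodgeConjecture h) hC,
    hc_av_iff_hc_cm_and_cmToAbelian⟩

/-! ## Audit: nothing is decided here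

Every theorem above has `HC_AV` (or the summit, or a named printed fact) among its hypotheses, or is an `↔` whose sides are open statements; no
new definition. Axiom closures: the three standard axioms only. -/

#print axioms Summit.Ventures.HSemireg.GeneralStructure.blochPresentedFamilies_iff_hc_av
#print axioms Summit.Ventures.HSemireg.GeneralStructure.uniformBlochLift_sandwich

end Summit.Ventures.HSemireg.GeneralStructure

end
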